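import Literature.Computability.QuantumComplexity.SignedCubicForrelation
import HarnessLib

/-!
# Signed exact cubic Forrelation with ANF-PRESENTED instances (`SignedExactCubicSliceANF`)

Topic `Literature/Computability/QuantumComplexity` (definition item `defn-SignedExactCubicSliceANF`,
decomp-qadv lens-3 request `D_ANF`, 2026-08-30).  Companion to `CubicForrelation.lean`
(`cubicKForrelationProblem`, `IsDegLeFun`, `polyPhase`) and `SignedCubicForrelation.lean`
(`signedExactCubicForrelationProblem k₀`: instances are explicit `k₀`-fold Forrelation instances given by
Boolean CIRCUITS, yes `Φ = 1`, no `Φ = -1`, every function of algebraic degree `≤ 3`).  Here the SAME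
signed exact slice at `k₀ = 2` is presented by **cubic algebraic normal forms** instead of circuits:

* `CubicForm n` — a cubic coefficient table in `n` variables over `𝔽₂`: a constant bit and an `n × n × n`
  table of bits `t i j l`, read as the polynomial `c + Σ_{i,j,l} t_{ijl} xᵢ xⱼ x_l ∈ 𝔽₂[x]` of total
  degree `≤ 3` (`CubicForm.toPoly`); on `{0,1}ⁿ` (where `x² = x`) the weight-`≤ 3` ANF coefficients
  `a_{{i}}, a_{{i<j}}, a_{{i<j<l}}` of Carlet 2020 §2.2.1 (2.1) sit at the sorted index triples `(i,i,i)`,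
  `(i,i,j)`, `(i,j,l)` — the "table of the `≤ n³` weight-`≤ 3` coefficients", of size `n³ + 1` bits;
  `CubicForm.eval := polyPhase ∘ toPoly` is the Boolean function it presents, and
  `CubicForm.isDegLeFun_eval : IsDegLeFun 3 F.eval` (`totalDegree (toPoly F) ≤ 3`);
* `CubicANFPair` — an instance: the arity `n` and two cubic forms `F, G` (the phase functions
  `f = (-1)^{F}`, `g = (-1)^{G}` of Aaronson–Ambainis Thm 26); `CubicANFPair.value := Φ_{f,g}`
  (`forrelation F.eval G.eval`); `CubicANFPair.encode : CubicANFPair → List Bool` — `anfEncode`: `n` in binary,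
  then the two tables flattened with the tree's `boolPair`/`encodeCodeList`; `encode_injective`; the
  decoder `CubicANFPair.decode` (left inverse, `decode_encode`);
* ★ `SignedExactCubicSliceANF : PromiseProblem` — yes: codes of pairs with `n` even and `Φ = 1`; no: codes of
  pairs with `n` even and `Φ = -1` — VERBATIM the yes/no CONDITIONS of `signedExactCubicForrelationProblem 2`
  (`IsOverB2`, `IsDegLeFun 3` being automatic for ANF-presented functions), with the instance presentation
  changed from circuits to ANF tables; `encode_mem_yes_iff`, `encode_mem_no_iff`, `disjoint`, non-vacuity of
  both sides (`exists_mem_yes`, `exists_mem_no`, at `n = 0`);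
* the function-level half of the presentation bridge: `CubicANFPair.toKForrelationValue` — for circuits
  `C₀, C₁` computing `F.eval, G.eval` the circuit instance `⟨n, 2, C⟩` has the same value `Φ`.

NOT HERE (documented for the requester): the presentation-equivalence `E_pres`
("circuit slice `∉ PromiseBPP'` ⟺ ANF slice `∉ PromiseBPP'`") needs (i) Karp-closure of
`Literature.Computability.Complexity.PromiseBPP'` (not in the tree), (ii) poly-time computability of
ANF → `B₂`-circuit compilation and of circuit → ANF extraction (`n³` evaluations on the weight-`≤ 3`
points + Möbius inversion, Carlet (2.3)), and (iii) the converse of `isDegLeFun_eval`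
(every `IsDegLeFun 3` function is `F.eval` for some `F` — multilinearisation `xᵢ² = xᵢ`); none of these is a
definition, and they are left to theorem files.

## References

* S. Aaronson, A. Ambainis, *Forrelation: a problem that optimally separates quantum from classical
  computing*, SIAM J. Comput. 47 (2018) 982–1038 (arXiv:1411.5729): §1.1.1 (`Φ_{f,g}`), §3.2 Prop. 6
  (acceptance `(1+Φ)/2`), §6 Thm 25–26 (p. 27: `fᵢ = (-1)^{p}`, `deg p ≤ 3`). [AaronsonAmbainis2018]
* C. Carlet, *Boolean Functions for Cryptography and Coding Theory*, CUP 2020, §2.2.1 (algebraic normal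
  form (2.1), binary Möbius transform (2.3), Def. 6 algebraic degree). [Carlet2020]
* O. Goldreich, *On promise problems* (2006), Def. 1.1. [Goldreich2006]
-/

noncomputable section

open Computability Literature.Computability.Complexity Literature.Computability.Cryptography Finset

namespace Literature.Computability.QuantumComplexity

/-! ### Cubic coefficient tables and the Boolean functions they present -/

/-- **A cubic coefficient table in `n` variables over `𝔽₂`** (the ANF presentation of a Boolean function
of algebraic degree `≤ 3`): a constant bit `const` and an `n × n × n` table `cube`, read as the polynomial
`const + Σ_{i,j,l} cube i j l · xᵢ xⱼ x_l`.  The weight-`≤ 3` ANF coefficients `a_I`, `|I| ≤ 3`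
(Carlet (2.1)) are placed at the sorted index triples (`a_{{i}}` at `(i,i,i)`, `a_{{i,j}}` at `(i,i,j)`,
`a_{{i,j,l}}` at `(i,j,l)`; on `{0,1}ⁿ`, `xᵢ² = xᵢ`). [cite: Carlet2020, §2.2.1 eq. (2.1) and Def. 6] -/
structure CubicForm (n : ℕ) where
  /-- The constant coefficient `a_∅`. -/
  const : Bool
  /-- The cubic-monomial coefficients: `cube i j l` multiplies `xᵢ xⱼ x_l`. -/
  cube : Fin n → Fin n → Fin n → Bool

namespace CubicForm

variable {n : ℕ}

/-- A bit read in `𝔽₂`. [cite: Carlet2020, §2.2.1 eq. (2.1)] -/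
def bit (b : Bool) : ZMod 2 := if b then 1 else 0

/-- The polynomial `const + Σ_{i,j,l} cube i j l · Xᵢ Xⱼ X_l ∈ 𝔽₂[X₀,…,X_{n-1}]` of a cubic table.
[cite: Carlet2020, §2.2.1 eq. (2.1)] -/
def toPoly (F : CubicForm n) : MvPolynomial (Fin n) (ZMod 2) :=
  MvPolynomial.C (bit F.const) +
    ∑ i : Fin n, ∑ j : Fin n, ∑ l : Fin n,
      MvPolynomial.C (bit (F.cube i j l)) * (MvPolynomial.X i * MvPolynomial.X j * MvPolynomial.X l)

/-- **The Boolean function presented by a cubic table**: `x ↦ [toPoly F (x) = 1]` (the phase function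
`(-1)^{p(x)}` of Aaronson–Ambainis Thm 26, read in `{0,1}`). [cite: Carlet2020, §2.2.1 eq. (2.1)]
[cite: AaronsonAmbainis2018, §6 Thm 26 (p. 27)] -/
def eval (F : CubicForm n) : (Fin n → Bool) → Bool :=
  polyPhase F.toPoly

/-- Unfolding of `eval`. [cite: Carlet2020, §2.2.1 eq. (2.1)] -/
theorem eval_def (F : CubicForm n) : F.eval = polyPhase F.toPoly := rfl

/-- The polynomial of a cubic table has total degree `≤ 3`. [cite: Carlet2020, §2.2.1 Def. 6] -/
theorem totalDegree_toPoly_le (F : CubicForm n) : F.toPoly.totalDegree ≤ 3 := by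
  unfold toPoly
  have hX : ∀ s : Fin n, (MvPolynomial.X (R := ZMod 2) s).totalDegree ≤ 1 := fun s => by
    rw [MvPolynomial.totalDegree_X]
  refine (MvPolynomial.totalDegree_add _ _).trans (max_le ?_ ?_)
  · simp [MvPolynomial.totalDegree_C]
  refine MvPolynomial.totalDegree_finsetSum_le fun i _ =>
    MvPolynomial.totalDegree_finsetSum_le fun j _ =>
      MvPolynomial.totalDegree_finsetSum_le fun l _ => ?_
  have h1 := MvPolynomial.totalDegree_mul (MvPolynomial.C (bit (F.cube i j l)))
    (MvPolynomial.X i * MvPolynomial.X j * MvPolynomial.X l)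
  have h2 := MvPolynomial.totalDegree_mul (MvPolynomial.X (R := ZMod 2) i * MvPolynomial.X j)
    (MvPolynomial.X l)
  have h3 := MvPolynomial.totalDegree_mul (MvPolynomial.X (R := ZMod 2) i) (MvPolynomial.X j)
  rw [MvPolynomial.totalDegree_C] at h1
  have := hX i; have := hX j; have := hX l
  omega

/-- **An ANF-presented function has algebraic degree `≤ 3`** (`IsDegLeFun 3`, the degree condition of
`cubicKForrelationProblem` / `signedExactCubicForrelationProblem`). [cite: Carlet2020, §2.2.1 Def. 6] -/
theorem isDegLeFun_eval (F : CubicForm n) : IsDegLeFun 3 F.eval :=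
  isDegLeFun_polyPhase F.totalDegree_toPoly_le

/-- The table with all coefficients `0` except the constant presents the constant function `const`.
[cite: Carlet2020, §2.2.1 eq. (2.1)] -/
theorem eval_const (c : Bool) (x : Fin n → Bool) :
    (⟨c, fun _ _ _ => false⟩ : CubicForm n).eval x = c := by
  cases c <;> simp [eval, toPoly, bit, polyPhase]

/-- Encoding of a cubic table: the constant bit, then the table flattened row by row
(`encodeCodeList` of `encodeCodeList`s of rows). [cite: AroraBarak2009, §0.1] -/
def encode (F : CubicForm n) : List Bool :=
  boolPair [F.const]
    (encodeCodeList (List.ofFn fun i => encodeCodeList (List.ofFn fun j => List.ofFn fun l => F.cube i j l)))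

/-- The table encoding is injective (at fixed arity). [cite: AroraBarak2009, §0.1] -/
theorem encode_injective : Function.Injective (encode (n := n)) := by
  rintro ⟨c, t⟩ ⟨c', t'⟩ h
  obtain ⟨h1, h2⟩ := boolPair_inj.1 h
  obtain rfl : c = c' := by simpa using h1
  obtain rfl : t = t' := by
    funext i j l
    have hi := congrFun (List.ofFn_injective (encodeCodeList_injective h2)) i
    have hj := congrFun (List.ofFn_injective (encodeCodeList_injective hi)) j
    exact congrFun (List.ofFn_injective hj) l
  rfl

end CubicForm

/-! ### ANF-presented instances of `2`-fold Forrelation and their encoding (`anfEncode`) -/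

/-- **An ANF-presented instance of (signed, exact, cubic) `2`-fold Forrelation**: the arity `n` and two
cubic coefficient tables `F`, `G` presenting the phase functions `f = (-1)^F`, `g = (-1)^G`.
[cite: AaronsonAmbainis2018, §1.1.1 and §6 Thm 26 (p. 27)] -/
structure CubicANFPair where
  /-- Number of input bits. -/
  n : ℕ
  /-- The first cubic form (`f = (-1)^F`). -/
  F : CubicForm n
  /-- The second cubic form (`g = (-1)^G`). -/
  G : CubicForm n

namespace CubicANFPair

/-- The forrelation value `Φ_{f,g}` of the two presented functions. [cite: AaronsonAmbainis2018, §1.1.1] -/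
def value (I : CubicANFPair) : ℝ :=
  forrelation I.F.eval I.G.eval

/-- **`anfEncode`**: the code `⟨n, ⟨code F, code G⟩⟩` of an ANF-presented instance (`n` in binary, the two
tables by `CubicForm.encode`), a string over `{0,1}` of length `O(n³)`. [cite: AroraBarak2009, §0.1] -/
def encode (I : CubicANFPair) : List Bool :=
  boolPair (encodeNat I.n) (boolPair I.F.encode I.G.encode)

/-- **The instance encoding is injective.** [cite: AroraBarak2009, §0.1] -/
theorem encode_injective : Function.Injective encode := by
  rintro ⟨n, F, G⟩ ⟨n', F', G'⟩ h
  obtain ⟨h1, h2⟩ := boolPair_inj.1 h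
  obtain rfl : n = n' := encodeNat_injective h1
  obtain ⟨h3, h4⟩ := boolPair_inj.1 h2
  obtain rfl : F = F' := CubicForm.encode_injective h3
  obtain rfl : G = G' := CubicForm.encode_injective h4
  rfl

/-- **The decoder** (left inverse of `encode`; junk `none` off the range). [cite: AroraBarak2009, §0.1] -/
def decode (w : List Bool) : Option CubicANFPair :=
  open Classical in if h : ∃ I, encode I = w then some (Classical.choose h) else none

/-- `decode (encode I) = some I`. [cite: AroraBarak2009, §0.1] -/
theorem decode_encode (I : CubicANFPair) : decode (encode I) = some I := by
  have h : ∃ J, encode J = encode I := ⟨I, rfl⟩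
  rw [decode, dif_pos h, Option.some.injEq]
  exact encode_injective (Classical.choose_spec h)

/-- Off the range of `encode` the decoder returns `none`. [cite: AroraBarak2009, §0.1] -/
theorem decode_eq_none {w : List Bool} (hw : ∀ I, encode I ≠ w) : decode w = none := by
  rw [decode, dif_neg (fun ⟨I, hI⟩ => hw I hI)]

/-- **Function-level bridge to the circuit presentation**: if circuits `C₀, C₁` on `n` inputs compute the
two presented functions, the explicit `2`-fold Forrelation instance `⟨n, 2, C⟩` has the same value `Φ`
and all its functions have algebraic degree `≤ 3`. [cite: AaronsonAmbainis2018, §6 Thm 26 (p. 27)] -/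
theorem toKForrelationValue (I : CubicANFPair) (C : Fin 2 → Circuit (Fin I.n))
    (h0 : (C 0).eval = I.F.eval) (h1 : (C 1).eval = I.G.eval) :
    (KForrelationInstance.mk I.n 2 C).value = I.value ∧
      ∀ i, IsDegLeFun 3 ((KForrelationInstance.mk I.n 2 C).C i).eval := by
  refine ⟨?_, fun i => ?_⟩
  · rw [KForrelationInstance.value_mk_two, h0, h1]; rfl
  · fin_cases i
    · simpa [h0] using I.F.isDegLeFun_eval
    · simpa [h1] using I.G.isDegLeFun_eval

end CubicANFPair

/-! ### The promise problem -/

/-- ★ **Signed exact cubic Forrelation, ANF-presented** (`D_ANF`): over codes of ANF-presented pairs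
`(F, G)` with `n` even, decide the SIGN of the exact forrelation value — yes: `Φ_{f,g} = 1`, no:
`Φ_{f,g} = -1` (`f = (-1)^F`, `g = (-1)^G`, automatically of algebraic degree `≤ 3`).  The yes/no conditions
are verbatim those of `signedExactCubicForrelationProblem 2` (whose instances are `B₂`-CIRCUITS computing
degree-`≤ 3` functions); only the presentation of the instances differs.  The one-control-qubit algorithm
accepts with probability exactly `(1 + Φ)/2 ∈ {0, 1}` on the promise.
[cite: AaronsonAmbainis2018, §3.2 Prop. 6 (pp. 11–12) and §6 Thm 25–26 (p. 27), with §1.1.1]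
[cite: Goldreich2006, Def. 1.1] -/
def SignedExactCubicSliceANF : PromiseProblem :=
  ⟨CubicANFPair.encode '' {I | Even I.n ∧ I.value = 1},
    CubicANFPair.encode '' {I | Even I.n ∧ I.value = -1}⟩

/-- Membership of a code in the yes-side. [cite: AaronsonAmbainis2018, §6 Thm 26 (p. 27)] -/
theorem CubicANFPair.encode_mem_yes_iff (I : CubicANFPair) :
    I.encode ∈ SignedExactCubicSliceANF.yes ↔ Even I.n ∧ I.value = 1 := by
  constructor
  · rintro ⟨J, hJ, hJI⟩
    rw [CubicANFPair.encode_injective hJI] at hJ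
    exact hJ
  · exact fun h => ⟨I, h, rfl⟩

/-- Membership of a code in the no-side. [cite: AaronsonAmbainis2018, §6 Thm 26 (p. 27)] -/
theorem CubicANFPair.encode_mem_no_iff (I : CubicANFPair) :
    I.encode ∈ SignedExactCubicSliceANF.no ↔ Even I.n ∧ I.value = -1 := by
  constructor
  · rintro ⟨J, hJ, hJI⟩
    rw [CubicANFPair.encode_injective hJI] at hJ
    exact hJ
  · exact fun h => ⟨I, h, rfl⟩

/-- **The ANF slice is a genuine promise problem**: no code is both a yes- and a no-instance
(`1 ≠ -1`, injectivity of the encoding). [cite: Goldreich2006, Def. 1.1] -/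
theorem SignedExactCubicSliceANF_disjoint : SignedExactCubicSliceANF.Disjoint := by
  refine Set.disjoint_left.2 ?_
  rintro w ⟨I, hI, rfl⟩ hno
  have h := (CubicANFPair.encode_mem_no_iff I).1 hno
  have : (1 : ℝ) = -1 := hI.2.symm.trans h.2
  norm_num at this

/-! ### Non-vacuity: both sides are populated already at arity `0` -/

/-- At arity `0` the forrelation of two constant functions is the product of their signs.
[cite: AaronsonAmbainis2018, §1.1.1] -/
private theorem forrelation_zero (f g : (Fin 0 → Bool) → Bool) (x₀ : Fin 0 → Bool) :
    forrelation f g = signOf (f x₀) * signOf (g x₀) := by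
  have huniv : (Finset.univ : Finset (Fin 0 → Bool)) = {x₀} :=
    Finset.eq_singleton_iff_unique_mem.2 ⟨Finset.mem_univ _, fun x _ => Subsingleton.elim _ _⟩
  rw [forrelation, huniv, Finset.sum_singleton, Finset.sum_singleton]
  simp [twist]

/-- A yes-instance: `n = 0`, `F = G = 0` (`Φ = 1`). [cite: AaronsonAmbainis2018, §1.1.1] -/
theorem SignedExactCubicSliceANF.exists_mem_yes : ∃ w, w ∈ SignedExactCubicSliceANF.yes := by
  refine ⟨CubicANFPair.encode ⟨0, ⟨false, fun _ _ _ => false⟩, ⟨false, fun _ _ _ => false⟩⟩,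
    (CubicANFPair.encode_mem_yes_iff _).2 ⟨⟨0, rfl⟩, ?_⟩⟩
  rw [CubicANFPair.value, forrelation_zero _ _ (fun _ => false)]
  simp [CubicForm.eval_const, signOf]

/-- A no-instance: `n = 0`, `F = 1`, `G = 0` (`Φ = -1`). [cite: AaronsonAmbainis2018, §1.1.1] -/
theorem SignedExactCubicSliceANF.exists_mem_no : ∃ w, w ∈ SignedExactCubicSliceANF.no := by
  refine ⟨CubicANFPair.encode ⟨0, ⟨true, fun _ _ _ => false⟩, ⟨false, fun _ _ _ => false⟩⟩,
    (CubicANFPair.encode_mem_no_iff _).2 ⟨⟨0, rfl⟩, ?_⟩⟩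
  rw [CubicANFPair.value, forrelation_zero _ _ (fun _ => false)]
  simp [CubicForm.eval_const, signOf]

end Literature.Computability.QuantumComplexity

end
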